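import Summits.HodgeConjecture.CorCM.GaloisOddMetacyclicCertificates
import HarnessLib

/-!
# `Gal(K/ℚ) ≅ C₅ ⋊₂ C₈` (the generator of `C₈` acting on `C₅` by an automorphism of ORDER FOUR) is BAD: a simple DEGENERATE
# CM abelian `20`-fold (kernel certificate)

COR-CM (cell `pub-hodgecm2`), binder seat b04 (gen 26), count-neutral claim CYCLIC-SEMIDIRECT-RESIDUE, part VII♯b — the first
metacyclic group with a FAITHFUL action of order `> 2` settled in the kernel: `C₅ ⋊₂ C₈ = ⟨u, y | u⁵ = y⁸ = 1, y u y⁻¹ = u²⟩`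
(order `40`, unique involution `y⁴`; not to be confused with `C₅ ⋊ C₈` with the INVERSION action `y u y⁻¹ = u⁻¹ = u⁴`, which is
GOOD — `CorCM/GaloisCyclicSemidirectEightFiveModEight`, `p = 5 ≡ 5 (mod 8)`).  Here the index-`4` abelian subgroup
`⟨y⁴⟩ × C₅ ≅ C₁₀` carries the Fourier analysis, the annihilator blocks on the orbit `{λ, λ², λ⁴, λ³}` of a character of `C₅` are
reduced norms in the cyclic algebra `(ℚ(ζ₅)/ℚ, ζ₅ ↦ ζ₅², −1)` of degree `4`, which is NOT a division algebra (index `2`): the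
gen-26 census (compute j199207, numpy rank of the annihilator system, EXHAUSTIVE over the `2²⁰` CM types) finds `6 416` degenerate
types, `6 400` of them PRIMITIVE — so the group is BAD, as the cyclic-algebra heuristic predicts (`m = 3 < 2j = 4`).  ONE primitive
degenerate type with a balanced set of size `8` (SAT, compute j199467) is recorded here and checked by `decide` through
`GaloisOddMetacyclic.exists_simple_degenerate_of_metacyclic_balanced` (`r = 2`, `k = 2`, `2⁴ ≡ 1 (mod 5)`).  KERNEL ONLY:
theorems; no definition, no named fact, no `sorry`.  `HC_CM` is neither used nor claimed.

THE CERTIFICATE (coordinates `(v, s) ↔ u^v y^s ∈ ℤ/5 × ℤ/8`, law `(v₁,s₁)(v₂,s₂) = (v₁ + 2^{s₁} v₂, s₁ + s₂)`, `c₀ = (0,4)`):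
`T₀ = {(0,0),(0,1),(0,2),(0,3),(1,4),(1,5),(1,6),(1,7),(2,1),(2,2),(2,3),(2,4),(3,0),(3,1),(3,2),(3,7),(4,0),(4,1),(4,2),(4,7)}`
(B-rank `21 − 8`), `D = {(0,0),(1,7),(2,2),(3,1),(3,4),(3,6),(4,3),(4,5)}`.

* **`exists_simple_degenerate_cyclic5_semidirect4_8`** — a simple degenerate abelian variety of dimension `20` with CM by `K`
  and a rational `(q,q)` class outside the divisor ring on some power.

## References

* [Shimura1998] G. Shimura, *Abelian Varieties with Complex Multiplication and Modular Functions*, §6.2 Thm. 3, §8.2 Prop. 26.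
* [Gordon1999HodgeAVSurvey] B. B. Gordon, *A survey of the Hodge conjecture for abelian varieties*, Thm. 6.4, §9.3.
-/

noncomputable section

open CategoryTheory CategoryTheory.Limits NumberField
open scoped BigOperators

namespace Summit.HodgeConjecture.CorCM.GaloisOddMetacyclic

open Literature.NumberTheory.ComplexMultiplication
open Literature.AlgebraicGeometry.Motives (AbelianVariety CMType)
open Literature.AlgebraicGeometry.HodgeTheory
open Literature.AlgebraicGeometry.ComplexMultiplication (IsCMTypeRealisation)
open Literature.AlgebraicGeometry.Pohlmann1968
open Literature.Barriers.HodgeConjecture (divisorClassesSpan)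

variable {K : Type} [Field K] [NumberField K] [IsCMField K] [IsGalois ℚ K]

set_option maxRecDepth 8000 in
/-- **`Gal(K/ℚ) ≅ C₅ ⋊₂ C₈` (`φ(1) = (·)²`, an action of order `4`): a simple DEGENERATE abelian `20`-fold with CM by `K`**, with a
rational `(q,q)` class outside the divisor ring on some power — by the balanced-set certificate `(T₀, D)` above, checked by `decide`.
[cite: Shimura1998, §6.2 Thm. 3 and §8.2 Prop. 26] [cite: Gordon1999HodgeAVSurvey, Thm. 6.4 and §9.3] -/
theorem exists_simple_degenerate_cyclic5_semidirect4_8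
    (φ : Multiplicative (ZMod (2 ^ (2 + 1))) →* MulAut (Multiplicative (ZMod 5)))
    (hφ : ∀ v : Multiplicative (ZMod 5), φ (Multiplicative.ofAdd 1) v = v ^ 2)
    (e : (K ≃ₐ[ℚ] K) ≃* Multiplicative (ZMod 5) ⋊[φ] Multiplicative (ZMod (2 ^ (2 + 1)))) :
    ∃ (Φ : CMType K) (φ₀ : K →+* ℂ) (A : AbelianVariety ℂ) (ι : 𝓞 K →+* End A)
      (θ : K →+* Module.End ℂ (complexBetti A.X 1)),
      IsPrimitive (ℂ ≃+* ℂ) Φ.1 φ₀ ∧ ¬ IsNondegenerate Φ ∧ IsCMTypeRealisation Φ A ι θ ∧ A.IsSimple ∧ A.dim = 20 ∧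
      ∃ n q : ℕ, ∃ x : complexBetti (⨁ fun _ : Fin n => A).X (2 * q), IsRationalClass x ∧
        IsOfHodgeType (⨁ fun _ : Fin n => A).dim (⨁ fun _ : Fin n => A).X (2 * q) q q x ∧
        x ∉ divisorClassesSpan (⨁ fun _ : Fin n => A).X (⨁ fun _ : Fin n => A).dim q := by
  obtain ⟨Φ, φ₀, A, ι, θ, h1, h2, h3, h4, h5, h6⟩ :=
    exists_simple_degenerate_of_metacyclic_balanced (k := 2) (K := K) (by norm_num) (by norm_num) 2 (by norm_num) φ hφ e
      {(0, 0), (0, 1), (0, 2), (0, 3), (1, 4), (1, 5), (1, 6), (1, 7), (2, 1), (2, 2), (2, 3), (2, 4), (3, 0), (3, 1), (3, 2),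
        (3, 7), (4, 0), (4, 1), (4, 2), (4, 7)}
      (by decide) (by decide) {(0, 0), (1, 7), (2, 2), (3, 1), (3, 4), (3, 6), (4, 3), (4, 5)} (by decide) (by decide)
  exact ⟨Φ, φ₀, A, ι, θ, h1, h2, h3, h4, by norm_num at h5; exact h5, h6⟩

end Summit.HodgeConjecture.CorCM.GaloisOddMetacyclic

end
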